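import Mathlib
import HarnessLib
import Summits.AtomisticToContinuum.Crystallization.Theses.PRVarianceCertificate
import Summits.AtomisticToContinuum.Crystallization.Theses.CrystalLocalRigidity
import Summits.AtomisticToContinuum.Crystallization.Theorems.PRVarianceCertificateCertificateBoundsEnergy
import Summits.AtomisticToContinuum.Crystallization.Theorems.LayeredLawsSelectHcp.Negative.Threshold

/-!
# Crux `GroundStateVarianceCertificate` (stmt-AtomisticToContinuum-11859), line `registered`:
# stub `stub_periodicMinimiser` — reduction to item 0627 and necessity

Helper file of route `PRVarianceCertificate`, crux `GroundStateVarianceCertificate`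
(`∃ P C, 0 < C ∧ e_LJ(P) ≤ -C/24 ∧ ∀ LJ ground states x, Σ_i s_i(x)² ≤ C · Σ_i t_i(x)`, with
`s_i = siteEnergy (r ↦ r⁻⁶) x i`, `t_i = siteEnergy (r ↦ r⁻¹²) x i`).  The line factors the crux into
ATTAINMENT of the periodic Lennard-Jones minimum in `ℝ³`,

  `stub_periodicMinimiser : ∃ P : PeriodicConfiguration 3, ∀ Q, e_LJ(P) ≤ e_LJ(Q)`,

and periodic DOMINATION of the ground-state quotient (the other stubs, not touched here).  This file
does NOT prove attainment — that is the shared open item stmt-AtomisticToContinuum-0627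
`CrysPeriodicMinAttained` (compactness of minimising sequences of periodic configurations with
unbounded periods; Blanc–Lewin 2015 §2.3, "completely open in dimension three").  It records,
kernel-checked:

* `stubPeriodicMinimiser_iff_crysPeriodicMinAttained` — the stub IS item 0627 (decl
  `CrystalLocalRigidity.CrysPeriodicMinAttained`) up to unfolding `IsLeast (Set.range e) (e P)`;
* `certificateWitness_rigid` — the sharp-constant normal form: by the route's PROVED supports
  (`certificateBoundsEnergy_proof`, `crysEnergyUpper_proof`, `CrysPeriodicBddBelow_holds`) and the
  proved Literature facts `LennardJonesGroundStatesExist_holds`, `BlancLewin2015_8_holds`, every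
  witness `(P, C)` of the crux has `e(P) = min_Q e(Q)`, `C = -24 · e(P)` and `E(N)/N → e(P)`
  (the conjunct-(i) half of the route's deciding theorem `closes`, replayed);
* `stubPeriodicMinimiser_of_groundStateVarianceCertificate` — hence the stub is NECESSARY for the
  crux;
* `groundStateVarianceCertificate_iff_attained_and_dominated` — the line is LOSSLESS: the crux is
  equivalent to attainment ∧ periodic domination `∀ ground states x ∃ Q, Σ s² ≤ (-24 e(Q)) Σ t`
  (`←` is the skeleton's assembly: `C := -24 e(P) > 0` by the tree's certified
  `e(fcc, a = 1) ≤ -1/2`, `Threshold.energyPerParticle_fccPC_one_le`).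

All statements are `[folklore]` bookkeeping around Blanc–Lewin 2015, §§1.1–2.3.
-/

noncomputable section

open scoped BigOperators
open Literature.MathematicalPhysics.StatisticalMechanics Filter Topology

namespace Summit.AtomisticToContinuum.Crystallization.Theorems.GroundStateVarianceCertificateLine

/-- **The stub is item 0627.** `∃ P, ∀ Q, e_LJ(P) ≤ e_LJ(Q)` over periodic configurations of `ℝ³`
is, after unfolding `IsLeast (Set.range e) (e P)`, the shared item
`CrystalLocalRigidity.CrysPeriodicMinAttained` (stmt-AtomisticToContinuum-0627). [folklore] -/
theorem stubPeriodicMinimiser_iff_crysPeriodicMinAttained :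
    (∃ P : PeriodicConfiguration 3, ∀ Q : PeriodicConfiguration 3,
      P.energyPerParticle lennardJones ≤ Q.energyPerParticle lennardJones) ↔
    Summit.AtomisticToContinuum.Crystallization.Theses.CrystalLocalRigidity.CrysPeriodicMinAttained := by
  unfold Summit.AtomisticToContinuum.Crystallization.Theses.CrystalLocalRigidity.CrysPeriodicMinAttained
  refine exists_congr fun P => ⟨fun h => ⟨⟨P, rfl⟩, ?_⟩, fun h Q => h.2 ⟨Q, rfl⟩⟩
  rintro _ ⟨Q, rfl⟩
  exact h Q

/-- **Sharp-constant normal form of a certificate witness.** If `0 ≤ C`, `e_LJ(P) ≤ -C/24` and every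
finite Lennard-Jones ground state `x` satisfies `Σ_i s_i(x)² ≤ C · Σ_i t_i(x)`, then `P` minimises the
energy per particle among periodic configurations of `ℝ³`, `C = -24 · e_LJ(P)`, and `E(N)/N → e_LJ(P)`.
Proof (the conjunct-(i) half of the route's deciding theorem): ground states exist
(`LennardJonesGroundStatesExist_holds`); the Cauchy–Schwarz/dilation algebra
(`certificateBoundsEnergy_proof`) gives `-C/24 ≤ E(N)/N` for `N ≥ 1`; `E(N)/N → e`
(`BlancLewin2015_8_holds`), so `-C/24 ≤ e`; trial states (`crysEnergyUpper_proof`) give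
`e ≤ ⨅_Q e(Q) ≤ e(Q)` (`ciInf_le`, `CrysPeriodicBddBelow_holds`); with `e(P) ≤ -C/24` the chain
closes up. [folklore] -/
theorem certificateWitness_rigid {P : PeriodicConfiguration 3} {C : ℝ} (hC : 0 ≤ C)
    (heP : P.energyPerParticle lennardJones ≤ -(C / 24))
    (hcert : ∀ (N : ℕ) (x : Fin N → EuclideanSpace ℝ (Fin 3)), IsGroundState lennardJones x →
      ∑ i, (siteEnergy (fun r => (r⁻¹) ^ 6) x i) ^ 2 ≤
        C * ∑ i, siteEnergy (fun r => (r⁻¹) ^ 12) x i) :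
    (∀ Q : PeriodicConfiguration 3,
        P.energyPerParticle lennardJones ≤ Q.energyPerParticle lennardJones) ∧
      C = -24 * P.energyPerParticle lennardJones ∧
      Tendsto (fun N : ℕ => groundStateEnergy lennardJones 3 N / N) atTop
        (𝓝 (P.energyPerParticle lennardJones)) := by
  -- Lennard-Jones ground states exist for every `N` (proved Literature fact)
  choose x hx using
    (show ∀ N : ℕ, ∃ y : Fin N → EuclideanSpace ℝ (Fin 3), IsGroundState lennardJones y from
      LennardJonesGroundStatesExist_holds)
  -- lower bound `-C/24 ≤ E(N)/N` for `N ≥ 1`: certificate + Cauchy–Schwarz/dilation (item 11864)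
  have hlow : ∀ N : ℕ, 0 < N → -(C / 24) ≤ groundStateEnergy lennardJones 3 N / N := by
    intro N hN
    have hN' : (0 : ℝ) < N := by exact_mod_cast hN
    have h1 :=
      _root_.Summit.AtomisticToContinuum.Crystallization.Theorems.certificateBoundsEnergy_proof
        C hC 3 N (x N) (hx N).1 (hcert N (x N) (hx N))
    rw [le_div_iff₀ hN', ← (hx N).2]
    calc -(C / 24) * N = -(C / 24 * N) := by ring
      _ ≤ _ := h1
  -- the thermodynamic limit `e = lim E(N)/N` exists (Blanc–Lewin 2015, (8))
  obtain ⟨e, -, hlim, -⟩ := BlancLewin2015_8_holds 3 (by norm_num) (by norm_num)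
  have hge : -(C / 24) ≤ e :=
    ge_of_tendsto hlim ((eventually_gt_atTop 0).mono fun N hN => hlow N hN)
  -- trial states: `e = limsup E(N)/N ≤ ⨅_Q e(Q)` (item 11865, proved)
  have hle : e ≤ ⨅ Q : PeriodicConfiguration 3, Q.energyPerParticle lennardJones := by
    have h0 := _root_.Summit.AtomisticToContinuum.Crystallization.Theorems.crysEnergyUpper_proof
    unfold _root_.Summit.AtomisticToContinuum.Crystallization.Theses.PricedLinkCensus.CrysEnergyUpper
      at h0
    rwa [hlim.limsup_eq] at h0
  -- the periodic energies are bounded below (proved), so `⨅_Q e(Q) ≤ e(Q)` for every `Q`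
  have hBdd : BddBelow (Set.range fun Q : PeriodicConfiguration 3 =>
      Q.energyPerParticle lennardJones) :=
    _root_.Summit.AtomisticToContinuum.Crystallization.Theses.PRVarianceCertificate.CrysPeriodicBddBelow_holds
  have hinf : ∀ Q : PeriodicConfiguration 3,
      (⨅ Q : PeriodicConfiguration 3, Q.energyPerParticle lennardJones) ≤
        Q.energyPerParticle lennardJones := fun Q => ciInf_le hBdd Q
  have hPe : P.energyPerParticle lennardJones ≤ e := heP.trans hge
  have heP' : e ≤ P.energyPerParticle lennardJones := hle.trans (hinf P)
  have heq : e = P.energyPerParticle lennardJones := le_antisymm heP' hPe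
  subst heq
  refine ⟨fun Q => hle.trans (hinf Q), ?_, hlim⟩
  linarith

/-- **Losslessness of the line.** The crux `GroundStateVarianceCertificate` is EQUIVALENT to
attainment of the periodic minimum (`stub_periodicMinimiser`) together with periodic domination of
the ground-state quotient, `∀ ground states x ∃ Q, Σ_i s_i² ≤ (-24 e(Q)) · Σ_i t_i`.
`→`: the witness `P` minimises and `C = -24 e(P)` (`certificateWitness_rigid`), so `Q := P`
dominates.  `←` (the skeleton's assembly): `P :=` the minimiser, `C := -24 e(P)`, positive since
`e(P) ≤ e(fcc, a = 1) ≤ -1/2` (`Threshold.energyPerParticle_fccPC_one_le`), and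
`Σ s² ≤ (-24 e(Q)) Σ t ≤ (-24 e(P)) Σ t` by minimality and `Σ t ≥ 0`. [folklore] -/
theorem groundStateVarianceCertificate_iff_attained_and_dominated :
    _root_.Summit.AtomisticToContinuum.Crystallization.Theses.PRVarianceCertificate.GroundStateVarianceCertificate ↔
    ((∃ P : PeriodicConfiguration 3, ∀ Q : PeriodicConfiguration 3,
        P.energyPerParticle lennardJones ≤ Q.energyPerParticle lennardJones) ∧
      ∀ (N : ℕ) (x : Fin N → EuclideanSpace ℝ (Fin 3)), IsGroundState lennardJones x →
        ∃ Q : PeriodicConfiguration 3,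
          ∑ i, (siteEnergy (fun r => (r⁻¹) ^ 6) x i) ^ 2 ≤
            (-24 * Q.energyPerParticle lennardJones) *
              ∑ i, siteEnergy (fun r => (r⁻¹) ^ 12) x i) := by
  constructor
  · rintro ⟨P, C, hC, heP, hcert⟩
    obtain ⟨hmin, rfl, -⟩ := certificateWitness_rigid hC.le heP hcert
    exact ⟨⟨P, hmin⟩, fun N x hx => ⟨P, hcert N x hx⟩⟩
  · rintro ⟨⟨P, hmin⟩, hdom⟩
    -- the periodic minimum is negative: `e(P) ≤ e(fcc at nearest-neighbour distance 1) ≤ -1/2`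
    have hneg : P.energyPerParticle lennardJones < 0 :=
      lt_of_le_of_lt ((hmin _).trans
        _root_.Summit.AtomisticToContinuum.Crystallization.Theorems.LayeredLawsSelectHcp.Negative.Threshold.energyPerParticle_fccPC_one_le)
        (by norm_num)
    refine ⟨P, -24 * P.energyPerParticle lennardJones, by linarith, le_of_eq (by ring), ?_⟩
    intro N x hx
    obtain ⟨Q, hQ⟩ := hdom N x hx
    -- `Σ_i t_i ≥ 0` (sums of twelfth powers of inverse distances)
    have ht : 0 ≤ ∑ i, siteEnergy (fun r => (r⁻¹) ^ 12) x i := by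
      refine Finset.sum_nonneg fun i _ => ?_
      unfold siteEnergy
      exact Finset.sum_nonneg fun k _ => by positivity
    calc ∑ i, (siteEnergy (fun r => (r⁻¹) ^ 6) x i) ^ 2
        ≤ (-24 * Q.energyPerParticle lennardJones) * ∑ i, siteEnergy (fun r => (r⁻¹) ^ 12) x i :=
          hQ
      _ ≤ (-24 * P.energyPerParticle lennardJones) * ∑ i, siteEnergy (fun r => (r⁻¹) ^ 12) x i :=
          mul_le_mul_of_nonneg_right (by linarith [hmin Q]) ht

/-- **Necessity of the stub.** The crux `GroundStateVarianceCertificate` implies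
`stub_periodicMinimiser` verbatim: its witness `P` is a periodic minimiser of the Lennard-Jones
energy per particle (first component of `groundStateVarianceCertificate_iff_attained_and_dominated`,
i.e. of `certificateWitness_rigid`). [folklore] -/
theorem stubPeriodicMinimiser_of_groundStateVarianceCertificate :
    _root_.Summit.AtomisticToContinuum.Crystallization.Theses.PRVarianceCertificate.GroundStateVarianceCertificate →
    ∃ P : PeriodicConfiguration 3, ∀ Q : PeriodicConfiguration 3,
      P.energyPerParticle lennardJones ≤ Q.energyPerParticle lennardJones :=
  fun h => (groundStateVarianceCertificate_iff_attained_and_dominated.1 h).1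

/-- Hence the crux implies the shared item 0627 `CrysPeriodicMinAttained` by name (the edge
item 11859 → item 0627; nothing here closes 0627). [folklore] -/
theorem crysPeriodicMinAttained_of_groundStateVarianceCertificate
    (h : _root_.Summit.AtomisticToContinuum.Crystallization.Theses.PRVarianceCertificate.GroundStateVarianceCertificate) :
    _root_.Summit.AtomisticToContinuum.Crystallization.Theses.CrystalLocalRigidity.CrysPeriodicMinAttained :=
  stubPeriodicMinimiser_iff_crysPeriodicMinAttained.1
    (stubPeriodicMinimiser_of_groundStateVarianceCertificate h)

/-- **The crux alone gives the summit's energetic conjunct (i).** `GroundStateVarianceCertificate`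
implies `HasPeriodicGroundStateEnergy lennardJones 3`: its witness `P` is a periodic minimiser
(`IsLeast` of the range of `e`) and `E(N)/N → e(P)` (`certificateWitness_rigid`). This is the
(i)-half of the route's deciding theorem `closes`, isolated as an edge crux 11859 → conjunct (i)
of `Crystallization`; conjunct (ii) is NOT claimed. [folklore] -/
theorem hasPeriodicGroundStateEnergy_of_groundStateVarianceCertificate :
    _root_.Summit.AtomisticToContinuum.Crystallization.Theses.PRVarianceCertificate.GroundStateVarianceCertificate →
    HasPeriodicGroundStateEnergy lennardJones 3 := by
  rintro ⟨P, C, hC, heP, hcert⟩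
  obtain ⟨hmin, -, hlim⟩ := certificateWitness_rigid hC.le heP hcert
  refine ⟨P, ⟨⟨P, rfl⟩, ?_⟩, hlim⟩
  rintro _ ⟨Q, rfl⟩
  exact hmin Q

end Summit.AtomisticToContinuum.Crystallization.Theorems.GroundStateVarianceCertificateLine

end
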